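import Mathlib

/-!
# Tool stub `stub_stagnationCurveOneLevel` of the line `Sketch`
# (crux `DyadicWallCascade.HalfSpaceHierarchy`, item stmt-AnomalousDissipation-18627)

Sorry-free discharge of the registered tool stub `stub_stagnationCurveOneLevel` of the lead's
skeleton (card `bernoulli-surface-topology`: stagnation curves of a steady Euler flow lie in one
Bernoulli level).

**Statement.**  Let `U ⊆ ℝ³` be open, `Q : ℝ³ → ℝ` be `C¹` on `U`, and suppose the steady Euler
momentum equation holds on `U` in the form `DV(X)[V X] + ∇Q(X) = 0` (`X ∈ U`).  If
`γ : ℝ → ℝ³` is a differentiable curve inside `U` consisting of stagnation points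
(`V (γ t) = 0` for all `t`), then `Q ∘ γ` is constant: `Q (γ s) = Q (γ t)` for all `s t`.

**Proof.**  At a stagnation point the convective term `DV(X)[V X] = DV(X)[0]` vanishes, so the
Euler equation gives `∇Q(γ t) = 0`, hence `DQ(γ t) = 0` (Riesz isometry).  Since `U` is open and
`Q` is `C¹` on `U`, `Q` is differentiable at `γ t`; by the chain rule `Q ∘ γ` has derivative
`DQ(γ t)[γ'(t)] = 0` at every `t`, and a differentiable function `ℝ → ℝ` with zero derivative is
constant (`is_const_of_deriv_eq_zero`).

Mathlib only; no named facts are used.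
-/

set_option linter.dupNamespace false

namespace Summit.AnomalousDissipation.AnomalousDissipation.Theorems.HalfSpaceHierarchy

/-- **Stagnation curves lie in one Bernoulli level.**  For a steady Euler flow
`DV(X)[V X] + ∇Q(X) = 0` on an open set `U ⊆ ℝ³` with `Q ∈ C¹(U)`, the function `Q` is constant
along every differentiable curve `γ` of stagnation points (`V ∘ γ = 0`) contained in `U`. -/
theorem stub_stagnationCurveOneLevel :
    ∀ (V : EuclideanSpace ℝ (Fin 3) → EuclideanSpace ℝ (Fin 3)) (Q : EuclideanSpace ℝ (Fin 3) → ℝ)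
      (U : Set (EuclideanSpace ℝ (Fin 3))), IsOpen U → ContDiffOn ℝ 1 Q U →
      (∀ X ∈ U, (fderiv ℝ V X) (V X) + gradient Q X = 0) →
      ∀ γ : ℝ → EuclideanSpace ℝ (Fin 3), Differentiable ℝ γ → (∀ t, γ t ∈ U) → (∀ t, V (γ t) = 0) →
        ∀ s t : ℝ, Q (γ s) = Q (γ t) := by
  intro V Q U hU hQ hEuler γ hγ hγU hV s t
  -- the gradient of `Q` vanishes at every stagnation point on the curve
  have hgrad : ∀ τ : ℝ, gradient Q (γ τ) = 0 := by
    intro τ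
    have h := hEuler (γ τ) (hγU τ)
    rwa [hV τ, map_zero, zero_add] at h
  -- hence so does the Fréchet derivative (Riesz isometry)
  have hfd : ∀ τ : ℝ, fderiv ℝ Q (γ τ) = 0 := by
    intro τ
    have h := hgrad τ
    unfold gradient at h
    exact (LinearIsometryEquiv.map_eq_zero_iff _).mp h
  -- `Q` is differentiable at each point of the curve (`U` open, `Q ∈ C¹(U)`)
  have hdiffQ : ∀ τ : ℝ, DifferentiableAt ℝ Q (γ τ) := fun τ =>
    (hQ.contDiffAt (hU.mem_nhds (hγU τ))).differentiableAt one_ne_zero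
  -- chain rule: `Q ∘ γ` has zero derivative everywhere
  have hderiv : ∀ τ : ℝ, HasDerivAt (Q ∘ γ) 0 τ := by
    intro τ
    have h := (hdiffQ τ).hasFDerivAt.comp_hasDerivAt τ (hγ τ).hasDerivAt
    rwa [hfd τ, zero_apply] at h
  have hdiff : Differentiable ℝ (Q ∘ γ) := fun τ => (hderiv τ).differentiableAt
  exact is_const_of_deriv_eq_zero hdiff (fun τ => (hderiv τ).deriv) s t

end Summit.AnomalousDissipation.AnomalousDissipation.Theorems.HalfSpaceHierarchy
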